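import Mathlib
import HarnessLib
import Summits.Ventures.LatticeQCDFlow.Scaling.PerfectRelaxationIMH

/-!
# LatticeQCDFlow / Scaling — the VOLUME LAW for monotone annealing on factorised systems (v2.5)

HONEST FRAMING: exact (Metropolis-corrected) sampling algorithms for lattice gauge theory; figures
of merit are autocorrelation/cost numbers at stated couplings and volumes; no continuum-physics
claim.

Venture `LatticeQCDFlow` (cell pub-lqcd), topic `Scaling`, FANOUT row 29 (theory2) — OUR WORK
(THEORY-2.md v2.5 §3.5 / §4 rows C3 and T2-AI(m)).  Finite-state, elementary; nothing is cited as
a fact.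

THE STATEMENT.  Take `m` independent sites with single-site state space a finite chain `Z`, a
single-site action coordinate `A : Z → ℝ` (monotone for the order of `Z` — always arrangeable by
sorting), and the factorised annealing protocol `S_k(φ) = β_k Σ_i A(φ_i)` with `β` monotone (the
non-interacting / strong-coupling-factorised regime of THEORY-2.md §3.2, T2-M′).  Let every layer
update the sites INDEPENDENTLY by a single-site kernel `K_k` that is non-negative, stationary for
`e^{−β_{k+1} A}` and stochastically monotone (heat bath, its lazy versions, flow-MCMC with a family
model law, …).  Then the non-equilibrium / stochastic-normalizing-flow effective sample size obeys

  `ÊSS ≤ (Π_k ESS(p_{k+1}, p_k))^m`            (`perfectRelaxation_volume_law`),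

i.e. it is EXPONENTIALLY SMALL IN THE VOLUME `m` at fixed protocol, with the single-site
perfect-relaxation rate `−Σ_k log ESS(p_{k+1}, p_k)` as the exponent; for flow-MCMC site layers
with model laws `e^{−γ_k A}` (any `γ_k`) this is `perfectRelaxation_volume_law_imh`.  Keeping
`ÊSS ≥ δ` therefore forces the number of layers `n` to grow with `m` (for a smooth protocol
`−Σ_k log ESS_k ≈ ℒ²/n`, so `n ≳ m ℒ² / log(1/δ)`: the thermodynamic-length × volume law of
THEORY-2.md §4 row C3, here a theorem for the monotone factorised class).

PROOF.  `Fin m → Z` is a finite distributive lattice, `S_k` is modular (a sum of single-site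
terms), its increments are monotone, the block kernel `Π_i K_k(φ_i, ψ_i)` is stationary for the
product weight and — the one new lemma, `blockKernel_antitone`, by induction on `m` peeling one
site at a time — preserves antitone functions when every `K_k` does.  So the FKG form (C3‴)
`perfectRelaxation_dominates_fkg` applies, and the perfect-relaxation product factorises over the
sites by `essFrac_blockProd_const`.

Contents: `blockKernel` (+ `_nonneg`, `sum_pi_cons`, `_cons`, `_sum_cons`, `_isStationary`,
`_sum_mul_mono`, `_antitone`), `siteSum` (+ `exp_neg_siteSum`, `partitionFn_siteSum`,
`gibbsLaw_siteSum`), `perfectRelaxation_volume_law`, `imhKernel_family_antitone`,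
`perfectRelaxation_volume_law_imh`.
-/

noncomputable section

namespace Summit.Ventures.LatticeQCDFlow.Theory2

open Finset Summit.Ventures.LatticeQCDFlow.Exactness

/-! ## Block (tensor-product) kernels on `Fin m → Z` -/

section BlockKernel

variable {m : ℕ} {Z : Type*} [Fintype Z]

/-- The block (tensor-product) kernel of `m` single-site kernels, `P(φ, ψ) = Π_i K_i(φ_i, ψ_i)`:
the `m` sites are updated independently. [folklore] -/
def blockKernel (K : Fin m → Z → Z → ℝ) (φ ψ : Fin m → Z) : ℝ := ∏ i, K i (φ i) (ψ i)

omit [Fintype Z] in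
/-- A block kernel of non-negative kernels is non-negative. [folklore] -/
theorem blockKernel_nonneg {K : Fin m → Z → Z → ℝ} (hK : ∀ i a b, 0 ≤ K i a b) (φ ψ : Fin m → Z) :
    0 ≤ blockKernel K φ ψ :=
  prod_nonneg fun i _ => hK i _ _

/-- Sums over `Fin (m+1) → Z` peel off the first coordinate. [folklore] -/
theorem sum_pi_cons (F : (Fin (m + 1) → Z) → ℝ) :
    ∑ φ : Fin (m + 1) → Z, F φ = ∑ z : Z, ∑ τ : Fin m → Z, F (Fin.cons z τ) := by
  rw [← (Fin.consEquiv fun _ : Fin (m + 1) => Z).sum_comp, Fintype.sum_prod_type]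
  rfl

omit [Fintype Z] in
/-- Peeling the first site off a block kernel. [folklore] -/
theorem blockKernel_cons (K : Fin (m + 1) → Z → Z → ℝ) (φ : Fin (m + 1) → Z) (z : Z)
    (τ : Fin m → Z) :
    blockKernel K φ (Fin.cons z τ) =
      K 0 (φ 0) z * blockKernel (fun i => K i.succ) (Fin.tail φ) τ := by
  simp only [blockKernel, Fin.prod_univ_succ, Fin.cons_zero, Fin.cons_succ, Fin.tail]

/-- Applying a block kernel = applying the first site kernel to the tail block kernel's output.
[folklore] -/
theorem blockKernel_sum_cons (K : Fin (m + 1) → Z → Z → ℝ) (f : (Fin (m + 1) → Z) → ℝ)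
    (χ : Fin (m + 1) → Z) :
    ∑ ψ, blockKernel K χ ψ * f ψ =
      ∑ z, K 0 (χ 0) z *
        ∑ τ : Fin m → Z, blockKernel (fun i => K i.succ) (Fin.tail χ) τ * f (Fin.cons z τ) := by
  rw [sum_pi_cons]
  refine sum_congr rfl fun z _ => ?_
  rw [mul_sum]
  refine sum_congr rfl fun τ _ => ?_
  rw [blockKernel_cons, mul_assoc]

/-- A block kernel of `w_i`-stationary site kernels is stationary for the product weight
`Π_i w_i(φ_i)`. [folklore] -/
theorem blockKernel_isStationary (w : Fin m → Z → ℝ) (K : Fin m → Z → Z → ℝ)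
    (h : ∀ i, Literature.Probability.MarkovChains.IsStationary (w i) (K i)) :
    Literature.Probability.MarkovChains.IsStationary (fun φ => ∏ i, w i (φ i)) (blockKernel K) := by
  intro ψ
  calc ∑ φ, (∏ i, w i (φ i)) * blockKernel K φ ψ
      = ∑ φ, blockProd (fun i z => w i z * K i z (ψ i)) φ :=
        sum_congr rfl fun φ _ => by simp only [blockKernel, blockProd, prod_mul_distrib]
    _ = ∏ i, ∑ z, w i z * K i z (ψ i) := sum_blockProd _
    _ = ∏ i, w i (ψ i) := prod_congr rfl fun i _ => h i (ψ i)

/-- Block kernels with non-negative entries are monotone in the integrand. [folklore] -/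
theorem blockKernel_sum_mul_mono {K : Fin m → Z → Z → ℝ} (hK : ∀ i a b, 0 ≤ K i a b)
    {f g : (Fin m → Z) → ℝ} (hfg : ∀ ψ, f ψ ≤ g ψ) (φ : Fin m → Z) :
    ∑ ψ, blockKernel K φ ψ * f ψ ≤ ∑ ψ, blockKernel K φ ψ * g ψ :=
  sum_le_sum fun ψ _ => mul_le_mul_of_nonneg_left (hfg ψ) (blockKernel_nonneg hK φ ψ)

end BlockKernel

section BlockKernelOrder

variable {Z : Type*} [Fintype Z] [Preorder Z]

/-- **Independent monotone site updates are monotone on the product poset.**  If every site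
kernel is non-negative and preserves antitone functions on `Z`, the block kernel preserves
antitone functions on `Fin m → Z` (coordinatewise order).  Induction on `m`: peel the first site,
use the induction hypothesis on the tail (antitone in the tail AND in the peeled value) and then the
first site's monotonicity. [folklore] -/
theorem blockKernel_antitone : ∀ (m : ℕ) (K : Fin m → Z → Z → ℝ), (∀ i a b, 0 ≤ K i a b) →
    (∀ (i : Fin m) (g : Z → ℝ), Antitone g → Antitone fun a => ∑ b, K i a b * g b) →
    ∀ f : (Fin m → Z) → ℝ, Antitone f → Antitone fun φ => ∑ ψ, blockKernel K φ ψ * f ψ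
  | 0, K, _, _, f, _ => fun φ φ' _ => by rw [Subsingleton.elim φ φ']
  | m + 1, K, hK0, hKm, f, hf => by
    have ih := blockKernel_antitone m (fun i => K i.succ) (fun i => hK0 i.succ) fun i => hKm i.succ
    have hgτ : ∀ z : Z, Antitone fun τ : Fin m → Z =>
        ∑ τ', blockKernel (fun i => K i.succ) τ τ' * f (Fin.cons z τ') := fun z =>
      ih (fun τ' => f (Fin.cons z τ')) fun a b hab => hf (Fin.cons_le_cons.2 ⟨le_rfl, hab⟩)
    have hgz : ∀ τ : Fin m → Z, Antitone fun z : Z =>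
        ∑ τ', blockKernel (fun i => K i.succ) τ τ' * f (Fin.cons z τ') := fun τ a b hab =>
      blockKernel_sum_mul_mono (fun i => hK0 i.succ)
        (fun τ' => hf (Fin.cons_le_cons.2 ⟨hab, le_rfl⟩)) τ
    intro φ φ' hφ
    show ∑ ψ, blockKernel K φ' ψ * f ψ ≤ ∑ ψ, blockKernel K φ ψ * f ψ
    rw [blockKernel_sum_cons, blockKernel_sum_cons]
    calc ∑ z, K 0 (φ' 0) z *
          ∑ τ', blockKernel (fun i => K i.succ) (Fin.tail φ') τ' * f (Fin.cons z τ')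
        ≤ ∑ z, K 0 (φ' 0) z *
          ∑ τ', blockKernel (fun i => K i.succ) (Fin.tail φ) τ' * f (Fin.cons z τ') :=
          sum_le_sum fun z _ =>
            mul_le_mul_of_nonneg_left (hgτ z fun i => hφ i.succ) (hK0 0 _ _)
      _ ≤ ∑ z, K 0 (φ 0) z *
          ∑ τ', blockKernel (fun i => K i.succ) (Fin.tail φ) τ' * f (Fin.cons z τ') :=
          hKm 0 _ (hgz (Fin.tail φ)) (hφ 0)

end BlockKernelOrder

/-! ## The factorised protocol and the volume law -/

section Volume

variable {Z : Type*} [LinearOrder Z] [Fintype Z] [Nonempty Z] {m n : ℕ}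

/-- The factorised (non-interacting) annealing protocol on `m` sites: `S_k(φ) = β_k Σ_i A(φ_i)`.
[folklore] -/
def siteSum (m : ℕ) (A : Z → ℝ) (β : Fin (n + 1) → ℝ) (k : Fin (n + 1)) (φ : Fin m → Z) : ℝ :=
  β k * ∑ i, A (φ i)

omit [LinearOrder Z] [Fintype Z] [Nonempty Z] in
/-- The Boltzmann weight of the factorised protocol factorises. [folklore] -/
theorem exp_neg_siteSum (A : Z → ℝ) (β : Fin (n + 1) → ℝ) (k : Fin (n + 1)) (φ : Fin m → Z) :
    Real.exp (-(siteSum m A β k φ)) = ∏ i, Real.exp (-(β k * A (φ i))) := by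
  rw [siteSum, mul_sum, ← sum_neg_distrib, Real.exp_sum]

omit [LinearOrder Z] [Nonempty Z] in
/-- The partition function of the factorised protocol is the `m`-th power of the single-site one.
[folklore] -/
theorem partitionFn_siteSum (A : Z → ℝ) (β : Fin (n + 1) → ℝ) (k : Fin (n + 1)) :
    partitionFn (siteSum m A β k) = partitionFn (fun z => β k * A z) ^ m := by
  unfold partitionFn
  simp_rw [exp_neg_siteSum]
  rw [show (∑ φ : Fin m → Z, ∏ i, Real.exp (-(β k * A (φ i)))) =
      ∑ φ, blockProd (fun (_ : Fin m) (z : Z) => Real.exp (-(β k * A z))) φ from rfl,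
    sum_blockProd, prod_const, card_univ, Fintype.card_fin]

omit [LinearOrder Z] [Nonempty Z] in
/-- The Gibbs law of the factorised protocol is the block product of the single-site Gibbs laws.
[folklore] -/
theorem gibbsLaw_siteSum (A : Z → ℝ) (β : Fin (n + 1) → ℝ) (k : Fin (n + 1)) :
    gibbsLaw (siteSum m A β k) = blockProd fun _ : Fin m => gibbsLaw fun z => β k * A z := by
  funext φ
  simp only [gibbsLaw, blockProd]
  rw [partitionFn_siteSum, exp_neg_siteSum, prod_div_distrib, prod_const, card_univ,
    Fintype.card_fin]

/-- **THE VOLUME LAW FOR MONOTONE FACTORISED ANNEALING (proved).**  `m` independent sites, a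
monotone single-site action coordinate `A` on the finite chain `Z`, the protocol
`S_k = β_k Σ_i A(φ_i)` with `β` monotone, and layers updating the sites independently by
single-site kernels `K_k ≥ 0` that are stationary for `e^{−β_{k+1} A}` and preserve antitone
functions (heat bath, lazy heat bath, flow-MCMC with family model laws, …):
`ÊSS(path) ≤ (Π_k ESS(p_{k+1}, p_k))^m` — exponentially small in the volume at fixed protocol.
[folklore] -/
theorem perfectRelaxation_volume_law (m : ℕ) (A : Z → ℝ) (hA : Monotone A)
    (β : Fin (n + 1) → ℝ) (hβ : Monotone β) (K : Fin n → Z → Z → ℝ)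
    (hK0 : ∀ k a b, 0 ≤ K k a b)
    (hKst : ∀ k : Fin n,
      Literature.Probability.MarkovChains.IsStationary (fun z => Real.exp (-(β k.succ * A z)))
        (K k))
    (hKmono : ∀ (k : Fin n) (g : Z → ℝ), Antitone g → Antitone fun a => ∑ b, K k a b * g b) :
    essFrac (revPathLaw (siteSum m A β) fun k => blockKernel fun _ : Fin m => K k)
        (pathLaw (gibbsLaw (siteSum m A β 0)) fun k => blockKernel fun _ : Fin m => K k) ≤
      (∏ k : Fin n, essFrac (gibbsLaw fun z => β k.succ * A z)
        (gibbsLaw fun z => β k.castSucc * A z)) ^ m := by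
  have h := perfectRelaxation_dominates_fkg (siteSum m A β)
    (fun k => blockKernel fun _ : Fin m => K k) ?_ ?_
    (fun k φ ψ => blockKernel_nonneg (fun _ => hK0 k) φ ψ) ?_ ?_
  · refine h.trans_eq ?_
    rw [← prod_pow]
    refine prod_congr rfl fun k _ => ?_
    rw [gibbsLaw_siteSum, gibbsLaw_siteSum]
    exact essFrac_blockProd_const (gibbsLaw_pos _) (sum_gibbsLaw _) m
  · -- the increments `(β_{k+1} − β_k) Σ_i A(φ_i)` are monotone
    intro k a b hab
    simp only [siteSum]
    rw [← sub_mul, ← sub_mul]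
    exact mul_le_mul_of_nonneg_left (sum_le_sum fun i _ => hA (hab i))
      (sub_nonneg.2 (hβ Fin.castSucc_lt_succ.le))
  · -- `S_k` is modular: on a chain `{a ⊓ b, a ⊔ b} = {a, b}` site by site
    intro k a b
    refine le_of_eq ?_
    simp only [siteSum, Pi.inf_apply, Pi.sup_apply]
    rw [← mul_add, ← mul_add, ← sum_add_distrib, ← sum_add_distrib]
    congr 1
    refine sum_congr rfl fun i _ => ?_
    rcases le_total (a i) (b i) with hle | hle
    · rw [inf_eq_left.2 hle, sup_eq_right.2 hle]
    · rw [inf_eq_right.2 hle, sup_eq_left.2 hle, add_comm]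
  · -- the block kernel is stationary for the product weight `e^{−S_{k+1}}`
    intro k
    have hw : (fun φ : Fin m → Z => Real.exp (-(siteSum m A β k.succ φ))) =
        fun φ => ∏ i, (fun (_ : Fin m) (z : Z) => Real.exp (-(β k.succ * A z))) i (φ i) := by
      funext φ
      exact exp_neg_siteSum A β k.succ φ
    rw [hw]
    exact blockKernel_isStationary _ _ fun _ => hKst k
  · -- the block kernel preserves antitone functions
    intro k f hf
    exact blockKernel_antitone m (fun _ => K k) (fun _ => hK0 k) (fun _ => hKmono k) f hf

/-- Flow-MCMC site kernels with target `e^{−bA}` and a family model law `∝ e^{−cA}` preserve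
antitone functions on the chain `Z` (`A` strictly monotone), whatever `c` is — from (C3-IMH)'s
`imhKernel_monotone_of_weight_antitone/monotone`: the weight `e^{−(b−c)A}` is monotone one way
or the other. [folklore] -/
theorem imhKernel_family_antitone (A : Z → ℝ) (hA : StrictMono A) (b c : ℝ) (g : Z → ℝ)
    (hg : Antitone g) :
    Antitone fun a => ∑ z,
      imhKernel (fun z => Real.exp (-(b * A z))) (gibbsLaw fun z => c * A z) a z * g z := by
  have hp : ∀ z : Z, 0 < Real.exp (-(b * A z)) := fun z => Real.exp_pos _
  have hq1 : ∑ z, gibbsLaw (fun z => c * A z) z = 1 := sum_gibbsLaw _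
  have hg' : ∀ x y : Z, A x ≤ A y → g y ≤ g x := fun x y h => hg (hA.le_iff_le.1 h)
  have hcross : ∀ x y : Z, Real.exp (-(b * A y)) * gibbsLaw (fun x => c * A x) x ≤
      Real.exp (-(b * A x)) * gibbsLaw (fun x => c * A x) y ↔ (b - c) * A x ≤ (b - c) * A y := by
    intro x y
    have hZ : 0 < partitionFn (fun x => c * A x) := partitionFn_pos _
    simp only [gibbsLaw]
    rw [mul_div_assoc', mul_div_assoc', div_le_div_iff_of_pos_right hZ, ← Real.exp_add,
      ← Real.exp_add, Real.exp_le_exp]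
    constructor <;> intro h <;> linarith
  intro x y hxy
  have hAxy : A x ≤ A y := hA.monotone hxy
  rcases le_total c b with hle | hle
  · exact imhKernel_monotone_of_weight_antitone hp hq1 A
      (fun x y h => (hcross x y).2 (mul_le_mul_of_nonneg_left h (sub_nonneg.2 hle))) g hg' x y hAxy
  · exact imhKernel_monotone_of_weight_monotone hp hq1 A
      (fun x y h => (hcross y x).2 (mul_le_mul_of_nonpos_left h (sub_nonpos.2 hle))) g hg' x y
      hAxy

/-- **Volume law for factorised flow-MCMC annealing (proved).**  Sites updated independently by
flow-MCMC (independence Metropolis) kernels with target `e^{−β_{k+1}A}` and model laws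
`∝ e^{−γ_k A}`, ARBITRARY `γ_k`: `ÊSS ≤ (Π_k ESS(p_{k+1}, p_k))^m`. [folklore] -/
theorem perfectRelaxation_volume_law_imh (m : ℕ) (A : Z → ℝ) (hA : StrictMono A)
    (β : Fin (n + 1) → ℝ) (hβ : Monotone β) (γ : Fin n → ℝ) :
    essFrac
        (revPathLaw (siteSum m A β) fun k => blockKernel fun _ : Fin m =>
          imhKernel (fun z => Real.exp (-(β k.succ * A z))) (gibbsLaw fun z => γ k * A z))
        (pathLaw (gibbsLaw (siteSum m A β 0)) fun k => blockKernel fun _ : Fin m =>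
          imhKernel (fun z => Real.exp (-(β k.succ * A z))) (gibbsLaw fun z => γ k * A z)) ≤
      (∏ k : Fin n, essFrac (gibbsLaw fun z => β k.succ * A z)
        (gibbsLaw fun z => β k.castSucc * A z)) ^ m := by
  have hp : ∀ (k : Fin n) (z : Z), 0 < Real.exp (-(β k.succ * A z)) := fun k z => Real.exp_pos _
  exact perfectRelaxation_volume_law m A hA.monotone β hβ _
    (fun k a b => (imhKernel_isRowStochastic (hp k) (fun z => (gibbsLaw_pos _ z).le)
      (sum_gibbsLaw _)).1 a b)
    (fun k => imhKernel_isStationary (hp k) _)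
    (fun k g hg => imhKernel_family_antitone A hA (β k.succ) (γ k) g hg)

end Volume

end Summit.Ventures.LatticeQCDFlow.Theory2

end
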